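import Summits.Ventures.YMGap.RobustBall.PerturbedMassiveBridge
import Summits.Ventures.YMGap.RobustBall.RowsSU2
import HarnessLib

/-!
# Venture YMGap, track ROBUST-BALL — «MASS GAP ON THE BALL ⇒ EVERY DLR STATE OF EVERY MEMBER IS
# MASSIVE»: the `d = 4` conversion and the hypothesis-free `SU(2)` massive rows on the ball

HONEST FRAMING. WHAT THIS IS: a venture file (cell `pub-ymgap`, track Y2 ROBUST-BALL, seat ds-3),
strong-coupling LATTICE statement for `SU(N)` lattice Yang–Mills on `ℤ⁴` with a PERTURBED action
`N β S_W + W`, `(W, supp)` in rb-p1's tier-1 ball `MemBallZd ε₀ ε₁ R`. A currency conversion,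
kernel-checked and hypothesis-free: rb-p1's `PerturbedMassGapAt 4 N β W supp` (unique DLR state +
Shen–Zhu–Zhu clustering of Lipschitz cylinder functions for the MEMBER's specification) implies that
EVERY DLR state `μ` of the member is a MASSIVE STATE of the barrier catalogue
(`Literature.Barriers.QuantumFields.IsMassiveState`: one rate for all truncated correlations of bounded
measurable local observables; `isMassiveState_of_perturbedMassGapAt`) whose plaquette–plaquette
correlation function decays exponentially (`hasExponentialDecay_plaquetteCorrFn_of_perturbedMassGapAt`).
Hence rb-p1's target type `MassGapOnBallZd 4 N β ε₀ ε₁ R` is at once an every-DLR-state-massive statement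
for every member (`isMassiveState_onBallZd`), and — with rb-p1's hypothesis-free `su2_massGapOnBallZd_dim4`
— for `SU(2)` at every `(β_W, ε₀, ε₁)` with `6|β_W| e^{ε₀} + e^{ε₀/2} √(2/3) ε₁ < 1` every member of the
ball has DLR states and ALL of them are massive with plaquette–plaquette decay
(`su2_massive_onBallZd_dim4`, Wilson reading `su2_isMassiveState_onBallZd_wilson`), and every CERTIFIED
ROW of rb-p1's `RowsSU2.lean` (rb-ref lineage R) is at once a massive row
(`massive_onBallZd_of_massGapOnBallZd`; spelled out for the headline row `(β⋆_W, ε) = (1/8, 0.143)`, the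
largest-coupling row `(1/6, 0.049)` and the all-`β` lineage-A row `(1/16, 0.294)`). WHAT IT IS NOT: no new
threshold, no new `(β⋆, ε)` number (the certified table is rb-p1's / rb-ref's), no rate beyond the
`∃ c > 0` of `PerturbedMassGapAt`; nothing about the continuum, confinement, a transfer-matrix gap or the
Clay problem.

References: H. Shen, R. Zhu, X. Zhu, CMP 400 (2023) 805–851; K. Osterwalder, E. Seiler, Ann. Phys. 110
(1978) 440, §4; I. Montvay, G. Münster (1994) §3.4.5, §3.7; rb-theory `HOME/rb/ROBUST-BALL-DESIGN.md`
v0.2 §3.2, `HEADLINE-CANDIDATES.md` row 1a/1b.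
-/

noncomputable section

open MeasureTheory ProbabilityTheory Function Finset Filter Topology
open scoped NNReal
open Literature.Probability.LatticeModels
open Literature.Probability.LatticeModels.DobrushinMetric
open Literature.MathematicalPhysics.QuantumLattice
open Literature.MathematicalPhysics.QuantumFieldTheory hiding ZdEdge
open Literature.MathematicalPhysics.QuantumFieldTheory.Balaban1983to89
open Literature.MathematicalPhysics.QuantumFieldTheory.Balaban1983to89.StrongCouplingTorusWindow
open Literature.Barriers.QuantumFields (IsMassiveState)
open Summit.Ventures.YMGap.ZdSmoothing

namespace Summit.Ventures.YMGap.RobustBall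

variable {d N : ℕ}

/-! ### `d = 4`: every DLR state of a member with the mass gap is massive, with plaquette–plaquette decay -/

/-- ★ **`PerturbedMassGapAt 4 N β W supp` ⇒ EVERY DLR STATE OF THE MEMBER IS MASSIVE** (`SU(N)` lattice
Yang–Mills on `ℤ⁴` with the action `N β S_W + W`, `(W, supp)` in the tier-1 ball `MemBallZd ε₀ ε₁ R`, every
`N ≥ 1`): clause (ii) of rb-p1's `PerturbedMassGapAt` (Shen–Zhu–Zhu clustering of Lipschitz cylinder
functions) upgrades, by DLR smoothing with the `W`-collar and at the same rate, to
`Literature.Barriers.QuantumFields.IsMassiveState μ` for every DLR state `μ` of the member. -/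
theorem isMassiveState_of_perturbedMassGapAt (hN : 1 ≤ N) {β ε₀ ε₁ R : ℝ}
    {W : Potential (ZdEdge 4) (Matrix.specialUnitaryGroup (Fin N) ℂ)}
    {supp : Finset (ZdEdge 4) → Finset (Finset (ZdEdge 4))} (hmem : MemBallZd ε₀ ε₁ R W supp)
    (h : PerturbedMassGapAt 4 N β W supp) :
    ∀ μ ∈ perturbedGibbsMeasures (d := 4) (fundamentalRep (Fin N)) ((N : ℝ) * β) W supp,
      IsMassiveState μ := by
  intro μ hμ
  obtain ⟨c, hc, hcl⟩ := h.2 μ hμ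
  refine ⟨c, fun F₁ F₂ h₁ h₂ h₁m h₂m hb₁ hb₂ _ _ => ?_⟩
  obtain ⟨C, hC⟩ := perturbed_covariance_decay_of_memBallZd (d := 4) (by norm_num) hN ((N : ℝ) * β) hmem
    hμ hc hcl F₁ F₂ h₁ h₂ h₁m h₂m hb₁ hb₂
  exact ⟨hc, C, hC⟩

/-- **Plaquette–plaquette decay of every DLR state of the member**: under `PerturbedMassGapAt 4 N β W supp`
the plaquette–plaquette correlation function `plaquetteCorrFn` (Chatterjee's `f_β`) of every DLR state of
the member decays exponentially (tree criterion
`not_exists_clusteringRate_of_not_hasExponentialDecay_plaquetteCorrFn`). -/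
theorem hasExponentialDecay_plaquetteCorrFn_of_perturbedMassGapAt (hN : 1 ≤ N) {β ε₀ ε₁ R : ℝ}
    {W : Potential (ZdEdge 4) (Matrix.specialUnitaryGroup (Fin N) ℂ)}
    {supp : Finset (ZdEdge 4) → Finset (Finset (ZdEdge 4))} (hmem : MemBallZd ε₀ ε₁ R W supp)
    (h : PerturbedMassGapAt 4 N β W supp) :
    ∀ μ ∈ perturbedGibbsMeasures (d := 4) (fundamentalRep (Fin N)) ((N : ℝ) * β) W supp,
      HasExponentialDecay (plaquetteCorrFn (fundamentalRep (Fin N)) μ) := by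
  intro μ hμ
  haveI : SecondCountableTopology (Matrix (Fin N) (Fin N) ℂ) :=
    inferInstanceAs (SecondCountableTopology (Fin N → Fin N → ℂ))
  haveI : SecondCountableTopology (Matrix.specialUnitaryGroup (Fin N) ℂ) :=
    Topology.IsEmbedding.subtypeVal.secondCountableTopology
  have hGibbs : IsGibbsMeasure (perturbedYM (d := 4) (fundamentalRep (Fin N)) ((N : ℝ) * β) W supp) μ := hμ
  haveI : IsProbabilityMeasure μ := hGibbs.isProbabilityMeasure
  have hm := isMassiveState_of_perturbedMassGapAt hN hmem h μ hμ
  by_contra hneg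
  exact Literature.Barriers.QuantumFields.not_exists_clusteringRate_of_not_hasExponentialDecay_plaquetteCorrFn
    (fundamentalRep (Fin N)) (continuous_fundamentalRep (Fin N))
    (fun U => fundamentalRep_mem_unitaryGroup U) hneg hm

/-- ★★ **MASS GAP ON THE BALL ⇒ EVERY DLR STATE OF EVERY MEMBER IS MASSIVE**: rb-p1's target type
`MassGapOnBallZd 4 N β ε₀ ε₁ R` carries, for every member `(W, supp)` of the tier-1 `ℤ⁴` ball, massiveness
of every DLR state of `perturbedYM (fundamentalRep (Fin N)) (N β) W supp` — the standing conversion for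
every present and future ball row. -/
theorem isMassiveState_onBallZd (hN : 1 ≤ N) {β ε₀ ε₁ R : ℝ} (h : MassGapOnBallZd 4 N β ε₀ ε₁ R)
    {W : Potential (ZdEdge 4) (Matrix.specialUnitaryGroup (Fin N) ℂ)}
    {supp : Finset (ZdEdge 4) → Finset (Finset (ZdEdge 4))} (hmem : MemBallZd ε₀ ε₁ R W supp) :
    ∀ μ ∈ perturbedGibbsMeasures (d := 4) (fundamentalRep (Fin N)) ((N : ℝ) * β) W supp,
      IsMassiveState μ :=
  isMassiveState_of_perturbedMassGapAt hN hmem (h W supp hmem)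

/-- **Mass gap on the ball ⇒ plaquette–plaquette decay for every DLR state of every member.** -/
theorem hasExponentialDecay_plaquetteCorrFn_onBallZd (hN : 1 ≤ N) {β ε₀ ε₁ R : ℝ}
    (h : MassGapOnBallZd 4 N β ε₀ ε₁ R)
    {W : Potential (ZdEdge 4) (Matrix.specialUnitaryGroup (Fin N) ℂ)}
    {supp : Finset (ZdEdge 4) → Finset (Finset (ZdEdge 4))} (hmem : MemBallZd ε₀ ε₁ R W supp) :
    ∀ μ ∈ perturbedGibbsMeasures (d := 4) (fundamentalRep (Fin N)) ((N : ℝ) * β) W supp,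
      HasExponentialDecay (plaquetteCorrFn (fundamentalRep (Fin N)) μ) :=
  hasExponentialDecay_plaquetteCorrFn_of_perturbedMassGapAt hN hmem (h W supp hmem)

/-- **Packaging: a ball row is a massive-ball row.** `MassGapOnBallZd 4 N β ε₀ ε₁ R` (any `N ≥ 1`) gives,
for every member `(W, supp)` of `MemBallZd ε₀ ε₁ R`: DLR states exist (`perturbedGibbsMeasures_nonempty`) and
every DLR state is massive with exponentially decaying plaquette–plaquette correlation function. Every
certified row of rb-p1's `RowsSU2.lean` converts through this lemma. -/
theorem massive_onBallZd_of_massGapOnBallZd (hN : 1 ≤ N) {β ε₀ ε₁ R : ℝ}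
    (h : MassGapOnBallZd 4 N β ε₀ ε₁ R)
    {W : Potential (ZdEdge 4) (Matrix.specialUnitaryGroup (Fin N) ℂ)}
    {supp : Finset (ZdEdge 4) → Finset (Finset (ZdEdge 4))} (hmem : MemBallZd ε₀ ε₁ R W supp) :
    (perturbedGibbsMeasures (d := 4) (fundamentalRep (Fin N)) ((N : ℝ) * β) W supp).Nonempty ∧
      ∀ μ ∈ perturbedGibbsMeasures (d := 4) (fundamentalRep (Fin N)) ((N : ℝ) * β) W supp,
        IsMassiveState μ ∧ HasExponentialDecay (plaquetteCorrFn (fundamentalRep (Fin N)) μ) := by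
  haveI : SecondCountableTopology (Matrix (Fin N) (Fin N) ℂ) :=
    inferInstanceAs (SecondCountableTopology (Fin N → Fin N → ℂ))
  haveI : SecondCountableTopology (Matrix.specialUnitaryGroup (Fin N) ℂ) :=
    Topology.IsEmbedding.subtypeVal.secondCountableTopology
  exact ⟨perturbedGibbsMeasures_nonempty _ (continuous_fundamentalRep (Fin N)) _ hmem.continuous
      hmem.dependsOn hmem.supportedBy,
    fun μ hμ => ⟨isMassiveState_onBallZd hN h hmem μ hμ,
      hasExponentialDecay_plaquetteCorrFn_onBallZd hN h hmem μ hμ⟩⟩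

/-! ### `SU(2)`: the hypothesis-free massive rows on the ball, `d = 4`, Wilson units -/

/-- ★★ **EVERY DLR STATE OF EVERY MEMBER OF THE `SU(2)` BALL IS MASSIVE, HYPOTHESIS-FREE** (`d = 4`,
Wilson units: 't Hooft `β = β_W/4`, tree coupling `β_W/2`): for every `β_W, ε₀, ε₁, R` with
`6|β_W| e^{ε₀} + e^{ε₀/2} √(2/3) ε₁ < 1`, every member `(W, supp)` of the tier-1 `ℤ⁴` ball
`MemBallZd ε₀ ε₁ R` — continuous adapted link potential of range `R`, oscillation load `≤ ε₀` and
cross-Lipschitz load `≤ ε₁` at every link, added to the `SU(2)` Wilson action at `β_W` — has DLR states,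
and EVERY one of them is a MASSIVE STATE of the barrier catalogue (`IsMassiveState`: one rate for all
truncated correlations of bounded measurable local observables) whose plaquette–plaquette correlation
function decays exponentially. One-link input: rb-p1's `su2_massGapOnBallZd_dim4` (sharp Poincaré
constant `2/3`, pair A). At `ε₀ = ε₁ = 0`: the Wilson rows `|β_W| < 1/6`. -/
theorem su2_massive_onBallZd_dim4 {βW ε₀ ε₁ : ℝ} (R : ℝ)
    (hρ : 6 * |βW| * Real.exp ε₀ + Real.exp (ε₀ / 2) * Real.sqrt (2 / 3) * ε₁ < 1)
    {W : Potential (ZdEdge 4) (Matrix.specialUnitaryGroup (Fin 2) ℂ)}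
    {supp : Finset (ZdEdge 4) → Finset (Finset (ZdEdge 4))} (hmem : MemBallZd ε₀ ε₁ R W supp) :
    (perturbedGibbsMeasures (d := 4) (fundamentalRep (Fin 2)) (((2 : ℕ) : ℝ) * (βW / 4)) W supp).Nonempty ∧
      ∀ μ ∈ perturbedGibbsMeasures (d := 4) (fundamentalRep (Fin 2)) (((2 : ℕ) : ℝ) * (βW / 4)) W supp,
        IsMassiveState μ ∧ HasExponentialDecay (plaquetteCorrFn (fundamentalRep (Fin 2)) μ) :=
  massive_onBallZd_of_massGapOnBallZd (by norm_num) (su2_massGapOnBallZd_dim4 (βW := βW) R hρ) hmem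

/-- **Wilson-coupling reading** (tree coupling `β_W/2`): under `6|β_W| e^{ε₀} + e^{ε₀/2} √(2/3) ε₁ < 1`,
every DLR state of `perturbedYM (fundamentalRep (Fin 2)) (β_W/2) W supp`, `(W, supp) ∈ MemBallZd ε₀ ε₁ R`,
is massive with plaquette–plaquette decay. -/
theorem su2_isMassiveState_onBallZd_wilson {βW ε₀ ε₁ : ℝ} (R : ℝ)
    (hρ : 6 * |βW| * Real.exp ε₀ + Real.exp (ε₀ / 2) * Real.sqrt (2 / 3) * ε₁ < 1)
    {W : Potential (ZdEdge 4) (Matrix.specialUnitaryGroup (Fin 2) ℂ)}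
    {supp : Finset (ZdEdge 4) → Finset (Finset (ZdEdge 4))} (hmem : MemBallZd ε₀ ε₁ R W supp) :
    ∀ μ ∈ perturbedGibbsMeasures (d := 4) (fundamentalRep (Fin 2)) (βW / 2) W supp,
      IsMassiveState μ ∧ HasExponentialDecay (plaquetteCorrFn (fundamentalRep (Fin 2)) μ) := by
  have e : (((2 : ℕ) : ℝ) * (βW / 4)) = βW / 2 := by push_cast; ring
  rw [← e]
  exact (su2_massive_onBallZd_dim4 R hρ hmem).2

/-! ### The certified rows of record become massive rows (`SU(2)`, `d = 4`; rb-p1 `RowsSU2`, rb-ref lineage R) -/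

/-- ★★ **HEADLINE ROW `(β⋆_W, ε) = (1/8, 0.143)` IS A MASSIVE ROW** (rb-p1 `su2_rowB_1_8`, sharp pair B;
convention `ε₀ = 2ε`, `ε₁ = ε`): every member of `MemBallZd 0.286 0.143 R` added to `SU(2)` Wilson at
`β_W = 1/8` on `ℤ⁴` has DLR states, all massive with plaquette–plaquette decay. -/
theorem su2_massive_row_1_8 (R : ℝ)
    {W : Potential (ZdEdge 4) (Matrix.specialUnitaryGroup (Fin 2) ℂ)}
    {supp : Finset (ZdEdge 4) → Finset (Finset (ZdEdge 4))}
    (hmem : MemBallZd (2 * (143 / 1000)) (143 / 1000) R W supp) :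
    (perturbedGibbsMeasures (d := 4) (fundamentalRep (Fin 2)) (((2 : ℕ) : ℝ) * ((1 / 8 : ℝ) / 4)) W supp).Nonempty ∧
      ∀ μ ∈ perturbedGibbsMeasures (d := 4) (fundamentalRep (Fin 2)) (((2 : ℕ) : ℝ) * ((1 / 8 : ℝ) / 4)) W supp,
        IsMassiveState μ ∧ HasExponentialDecay (plaquetteCorrFn (fundamentalRep (Fin 2)) μ) :=
  massive_onBallZd_of_massGapOnBallZd (by norm_num) (su2_rowB_1_8 R) hmem

/-- **Largest-coupling row `(β⋆_W, ε) = (1/6, 0.049)` is a massive row** (rb-p1 `su2_rowB_1_6`). -/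
theorem su2_massive_row_1_6 (R : ℝ)
    {W : Potential (ZdEdge 4) (Matrix.specialUnitaryGroup (Fin 2) ℂ)}
    {supp : Finset (ZdEdge 4) → Finset (Finset (ZdEdge 4))}
    (hmem : MemBallZd (2 * (49 / 1000)) (49 / 1000) R W supp) :
    (perturbedGibbsMeasures (d := 4) (fundamentalRep (Fin 2)) (((2 : ℕ) : ℝ) * ((1 / 6 : ℝ) / 4)) W supp).Nonempty ∧
      ∀ μ ∈ perturbedGibbsMeasures (d := 4) (fundamentalRep (Fin 2)) (((2 : ℕ) : ℝ) * ((1 / 6 : ℝ) / 4)) W supp,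
        IsMassiveState μ ∧ HasExponentialDecay (plaquetteCorrFn (fundamentalRep (Fin 2)) μ) :=
  massive_onBallZd_of_massGapOnBallZd (by norm_num) (su2_rowB_1_6 R) hmem

/-- **All-`β` lineage-A row `(β⋆_W, ε) = (1/16, 0.294)` is a massive row** (rb-p1 `su2_rowA_1_16`, pair A
`(2/3, 8/3)` — hypothesis-free at every `β_W`). -/
theorem su2_massive_row_1_16 (R : ℝ)
    {W : Potential (ZdEdge 4) (Matrix.specialUnitaryGroup (Fin 2) ℂ)}
    {supp : Finset (ZdEdge 4) → Finset (Finset (ZdEdge 4))}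
    (hmem : MemBallZd (2 * (147 / 500)) (147 / 500) R W supp) :
    (perturbedGibbsMeasures (d := 4) (fundamentalRep (Fin 2)) (((2 : ℕ) : ℝ) * ((1 / 16 : ℝ) / 4)) W supp).Nonempty ∧
      ∀ μ ∈ perturbedGibbsMeasures (d := 4) (fundamentalRep (Fin 2)) (((2 : ℕ) : ℝ) * ((1 / 16 : ℝ) / 4)) W supp,
        IsMassiveState μ ∧ HasExponentialDecay (plaquetteCorrFn (fundamentalRep (Fin 2)) μ) :=
  massive_onBallZd_of_massGapOnBallZd (by norm_num) (su2_rowA_1_16 R) hmem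

end Summit.Ventures.YMGap.RobustBall

end
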